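import Summits.BirchSwinnertonDyer.Rank1Residual.P2.ShuZhaiThirtySixAdmissible
import Summits.BirchSwinnertonDyer.Rank1Residual.P2.CornerFTwoModelClasses
import Literature.NumberTheory.EllipticCurves.ShuZhai2021.Base256c1
import HarnessLib

/-!
# Cell `bsd-print-cf2` (D-0131 (2) PRINT TIER, leaf CornerF @ `p = 2`), typer ty2 (discharge
# interface) — the curve `256c1 : y² = x³ + 2x` in the SETTING of Shu–Zhai 2021 Thm 1.2 / 1.4 / 4.10,
# every kernel-checkable hypothesis DISCHARGED

HONEST FRAMING (cell `bsd-print-cf2`, HOME `run/shared/lean/pub/bsd-print-cf2/`, verbatim in every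
file): the partition leaf is `CornerF W 2` — `W/ℚ` globally minimal elliptic WITH CM and
`ord_{s=1} L(E,s) = 1`, at the prime `2` (rung leaf `WAllCornerFTwo`; OPEN AS A CLASS). Nothing
class-wide is closed here; no named fact is introduced; nothing is asserted beyond kernel theorems
about ONE explicit curve and its twists. CONTEXT (lit g3, DOSSIER §16, STATUS 16:35:50Z): Shu–Zhai,
J. reine angew. Math. 775 (2021), Thms 1.2 / 1.4 / 4.10 carry no conductor bound, no CM exclusion and
no reduction-type restriction at `2`; at the CM base `E₀ = 256c1 : y² = x³ + 2x` (`j = 1728`,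
`K = ℚ(i)`, `2` RAMIFIED; Cremona 1992 Table 1: `256C1 = [0,0,0,2,0]` is the optimal curve of its class,
Table 4: `L(E₀,1)/Ω = 1/2`) they give, BY NAME, `ord_{s=1} L = rank = 1 ∧ BSD(W,2)` on the family
`W_{p,M} = E₀^{(−pM)} : y² = x³ + 2p²M²x` (`p ≡ 7 (mod 8)` prime, `M = q₁⋯q_{2k}`, `q_i ≡ 5 (mod 8)`
distinct primes) — members of the DECIDING residual crux stmt-BirchSwinnertonDyer-20509
`RamifiedOffTYZOfFacts` (conjunct (2) "`y² = x³ + Ax`, `A, −A ∉ ℤ²`" of the atlas iff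
`CornerFTwo.wAllCornerFTwoRamified_iff_models_of_transport`, off every `E_n`-family). The base curve and
the table fact `ShuZhai2021.base256c1_optimal_cuspZero` (S1 optimality, S3 `f([0]) ∉ 2E₀(ℚ)`) are the
cell's literature seat's `ShuZhai2021/Base256c1.lean` (p548891); THIS FILE discharges, in the kernel,
every OTHER hypothesis of the typed theorems (`ShuZhai2021.Thm12Setting`, `thm14_twoPartBSD_of_twists`,
`thm410_twoAdicValuations_of_twists`) at `E₀`, on the exact pattern of prover p3's
`P2/ShuZhaiThirtySixCurve.lean` + `P2/ShuZhaiThirtySixAdmissible.lean` (base `36a1`):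

* §1 `E₀′ = E₀/E₀[2](ℚ) = (y² = x³ − 8x) = 256c2` (`twoIsogenyCodomain_curve256c1`) and the rational
  `2`-isogeny of degree `2` (`exists_isogeny_curve256c1_degree_two`, the tree's PROVED `twoIsogeny`);
* §2 (S2 = (Tor)) `#E₀(ℚ)[2] = 2 = #E₀′(ℚ)[2]` (`natCard_twoTorsion_curve256c1`, `…curve256c1'`;
  reduction modulo the good prime `5`: `x² + 2` and `x² − 8` have no root mod `5`);
* §3 `N(E₀) ∣ 2⁸` (`conductorNorm_curve256c1_dvd`; Ogg / the universal bound `f₂ ≤ 8`) — the only prime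
  of `N` and of `2N` is `2`;
* §4 (S4) `K = ℚ(√−p)`, `p ≡ 7 (mod 8)`: `d_K = −p ≡ 1 (mod 8)`, so `2` splits — the Heegner hypothesis
  of Thm 1.2 for `N` and hypothesis (ii) of Thm 1.4 for `2N` at `K`
  (`allPrimesSplitInSqrt_conductorNorm_curve256c1`, `allPrimesSplitInSqrt_two_mul_conductorNorm_curve256c1`;
  Thm 4.10's "`p ≡ −1 (mod 8)`" is the same condition);
* §5 the assembled `thm12Setting_curve256c1 Dt hopt hcusp hp h8 hQ` (displays: `IsOptimalDatum`,
  `CuspZeroNotInTwice` — exactly the content of `base256c1_optimal_cuspZero` —, admissibility of `Q`);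
* §6 (S5) the Manin constant of `E₀` is odd, BY NAME from Agashe–Ribet–Stein 2006 Thm 2.6 (`N ≤ 130000`);
  (S6/S7 — admissible primes `q ≡ 5 (mod 8)` and the `ℚ(√M)`-condition — are the companion file
  `P2/ShuZhaiTwoFiftySixAdmissible.lean`);
* §7 the twists `E₀^{(D)} = (y² = x³ + 2D²x)` on the nose (`quadraticTwist_curve256c1`), their CM /
  ramified-at-`2` type and the leaf predicate `CornerF W 2` for their analytic-rank-one minimal models
  (`cornerF_two_of_smul_twist_curve256c1`) — PARTITION currency: slice RAM of rung W-ALL/12.K12-2.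

What remains for the SLICE (a ramified-road prover's Theorems/Target file, or an aside
`RamifiedShuZhaiTwoFiftySixOfFactsPlus` on the planner's TURNKEY, lit g3 16:47:38Z): displays
`hSZ12`/`hSZ14` (or `hSZ410`), `hARS`, `hbase : base256c1_optimal_cuspZero`, and `BSD(E₀,2)` for the
rank-zero CM base (`hBF : bsdTriple_of_hasCM_of_L_one_ne_zero` with `L(E₀,1) ≠ 0` from Thm 1.2 at
`Q = ∅`, as p3's `bsdp_two_curve36a1`). Beyond-print: NO (typed interface of printed hypotheses).

References: [ShuZhai2021] §1 (Thm 1.2, Def 1.1, (Tor), Thm 1.4), Thm 4.10 (arXiv:2102.11808 pp. 3, 13);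
[Cremona1997] Table 1 (N = 256, class C) and Table 4 (256C); [SilvermanAEC2009] III.4 Ex 4.5, VII.1 Rem 1.1,
VII.3.1(b), X.5 Prop 5.4; [Silverman1994] IV.11.1; [AgasheRibetStein2006] Thm 2.6; [Marcus1977] Ch. 2
Thm 1, Ch. 3 Thm 25; [Cox2013] §1 Lemma 1.14, §5.B Prop 5.16; HOME/DOSSIER.md §16 (lit g3).
-/

noncomputable section

open scoped Classical

open WeierstrassCurve NumberField Literature.NumberTheory.EllipticCurves
  Literature.NumberTheory.EllipticCurves.Rank1Residual
  Literature.NumberTheory.EllipticCurves.ModularForms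
  Literature.NumberTheory.EllipticCurves.ShuZhai2021
  Summit.BirchSwinnertonDyer.Rank1Residual
  Summit.BirchSwinnertonDyer.BirchSwinnertonDyer.Theorems.ConductorBoundOfBadPrimes

set_option autoImplicit false

namespace Summit.BirchSwinnertonDyer.Rank1Residual.P2

open Literature.NumberTheory.EllipticCurves.ShuZhai2021

attribute [instance] isElliptic_curve256c1 isGloballyMinimal_curve256c1

/-! ## §1 `E₀ = 256c1` and its `2`-isogenous curve `E₀′ = y² = x³ − 8x` (`256c2`) -/

/-- The integer equation of `E₀` base-changes to `E₀`. [folklore] -/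
theorem curve256c1Int_map :
    (⟨0, 0, 0, 2, 0⟩ : WeierstrassCurve ℤ).map (Int.castRingHom ℚ) = curve256c1 := by
  ext <;> simp [curve256c1, WeierstrassCurve.map]

/-- **`E₀′ = E₀/E₀[2](ℚ) = (y² = x³ − 8x) = 256c2`**: Vélu's codomain of the explicit `2`-isogeny
(Silverman III.4.5: `Y² = X³ − 2aX² + (a² − 4b)X` for `a = 0`, `b = 2`).
[cite: SilvermanAEC2009, III.4 Example 4.5] [cite: Cremona1997, Table 1 (class 256c)] -/
theorem twoIsogenyCodomain_curve256c1 :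
    curve256c1.twoIsogenyCodomain = (⟨0, 0, 0, -8, 0⟩ : WeierstrassCurve ℚ) := by
  ext <;> norm_num [WeierstrassCurve.twoIsogenyCodomain, curve256c1]

/-- The integer equation of `E₀′` base-changes to `E₀′`. [folklore] -/
theorem curve256c1'Int_map :
    (⟨0, 0, 0, -8, 0⟩ : WeierstrassCurve ℤ).map (Int.castRingHom ℚ) =
      (⟨0, 0, 0, -8, 0⟩ : WeierstrassCurve ℚ) := by
  ext <;> simp [WeierstrassCurve.map]

/-- `Δ(E₀′) = 2¹⁵ = 32768`. [folklore] -/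
theorem curve256c1'_Δ : (⟨0, 0, 0, -8, 0⟩ : WeierstrassCurve ℚ).Δ = 32768 := by
  simp only [WeierstrassCurve.Δ, WeierstrassCurve.b₂, WeierstrassCurve.b₄, WeierstrassCurve.b₆,
    WeierstrassCurve.b₈]
  norm_num

/-- `E₀′` is elliptic (`Δ = 2¹⁵ ≠ 0`). [folklore] -/
theorem isElliptic_curve256c1' : (⟨0, 0, 0, -8, 0⟩ : WeierstrassCurve ℚ).IsElliptic :=
  ⟨by rw [curve256c1'_Δ]; exact isUnit_iff_ne_zero.mpr (by norm_num)⟩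

/-- **`E₀` has CM (by `ℤ[i]`, `j = 1728`) and `2` is RAMIFIED in its CM field `ℚ(i)`** — `E₀` and all
its twists lie in the ramified type of the leaf (crux 20362 → child 20509). Via the atlas
(`hasCM_and_cmRamified_two_of_j`). [cite: SilvermanATAEC1994, App. A §3] -/
theorem hasCM_and_cmRamified_two_curve256c1 : curve256c1.HasCM ∧ CMRamified curve256c1 2 :=
  ⟨hasCM_curve256c1, cmRamified_two_curve256c1⟩

/-- **A rational `2`-isogeny `E₀ → E₀′` of degree `2`** (the tree's PROVED `twoIsogeny`, kernel
`{O, (0,0)}`). [cite: SilvermanAEC2009, III.4 Example 4.5] -/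
theorem exists_isogeny_curve256c1_degree_two :
    ∃ φ : Isogeny curve256c1 (⟨0, 0, 0, -8, 0⟩ : WeierstrassCurve ℚ), φ.degree = 2 := by
  haveI : curve256c1.IsTwoTorsionNF := ⟨rfl, rfl, rfl⟩
  rw [← twoIsogenyCodomain_curve256c1]
  exact ⟨curve256c1.twoIsogeny, degree_twoIsogeny curve256c1⟩

/-! ## §2 (Tor): `#E₀(ℚ)[2] = 2 = #E₀′(ℚ)[2]`, by reduction modulo `5` -/

/-- In a group whose `2`-torsion is `{0, T}` with `T ≠ 0`, `2•T = 0`, the `2`-torsion subtype has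
exactly two elements. [folklore] -/
private theorem natCard_twoTorsion_eq_two_of_subset {A : Type*} [AddCommGroup A] {T : A} (hT0 : T ≠ 0)
    (hT2 : (2 : ℕ) • T = 0) (h : ∀ τ : A, (2 : ℤ) • τ = 0 → τ = 0 ∨ τ = T) :
    Nat.card {P : A // (2 : ℕ) • P = 0} = 2 := by
  rw [Nat.card_eq_two_iff]
  refine ⟨⟨0, smul_zero _⟩, ⟨T, hT2⟩, fun he => hT0 (Subtype.mk.inj he).symm, ?_⟩
  ext ⟨τ, hτ⟩
  simp only [Set.mem_insert_iff, Set.mem_singleton_iff, Set.mem_univ, iff_true]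
  have hτ' : (2 : ℤ) • τ = 0 := by rw [← natCast_zsmul] at hτ; exact_mod_cast hτ
  rcases h τ hτ' with rfl | rfl
  · exact Or.inl rfl
  · exact Or.inr rfl

/-- **(Tor) for `E₀`: `#E₀(ℚ)[2] = 2`** — `E₀(ℚ)[2] = {O, (0,0)}`: modulo the good odd prime `5` the
only affine `2`-torsion point of `Ẽ₀(𝔽₅)` is `(0,0)` (`x² + 2` has no root mod `5`), and prime-to-`5`
torsion injects (tree `Rank2Observatory.twoTorsion_eq_zero_or_eq`). Shu–Zhai's (Tor) for `y² = x³ + Ax`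
reads `A ∉ ℚ²` here. [cite: ShuZhai2021, §1 condition (Tor) (arXiv:2102.11808 p. 3)]
[cite: SilvermanAEC2009, Prop. VII.3.1(b)] -/
theorem natCard_twoTorsion_curve256c1 :
    Nat.card {P : curve256c1.toAffine.Point // (2 : ℕ) • P = 0} = 2 := by
  rw [← curve256c1Int_map]
  haveI : Fact (Nat.Prime 5) := ⟨by norm_num⟩
  set V : WeierstrassCurve ℤ := ⟨0, 0, 0, 2, 0⟩ with hV
  have hT : (0 : ℤ) ^ 2 + V.a₁ * 0 * 0 + V.a₃ * 0 = 0 ^ 3 + V.a₂ * 0 ^ 2 + V.a₄ * 0 + V.a₆ := by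
    simp [hV]
  have hT2 : 2 * (0 : ℤ) + V.a₁ * 0 + V.a₃ = 0 := by simp [hV]
  have hΔ : ¬ ((5 : ℕ) : ℤ) ∣ V.Δ := by
    simp only [hV, WeierstrassCurve.Δ, WeierstrassCurve.b₂, WeierstrassCurve.b₄,
      WeierstrassCurve.b₆, WeierstrassCurve.b₈]
    norm_num
  have hB : BirchSwinnertonDyer.Rank2Observatory.twoTorsionOnlyB V 5 0 0 = true := by
    rw [hV]; decide +kernel
  have h := BirchSwinnertonDyer.Rank2Observatory.twoTorsion_eq_zero_or_eq V hT hT2 5 hΔ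
    (by norm_num) hB
  haveI := BirchSwinnertonDyer.Rank2Observatory.isElliptic_rat V
    (BirchSwinnertonDyer.Rank2Observatory.Δ_ne_zero_of_not_dvd V hΔ)
  refine natCard_twoTorsion_eq_two_of_subset (Affine.Point.some_ne_zero _) ?_ h
  exact BirchSwinnertonDyer.Rank2Observatory.two_nsmul_some_eq_zero V
    (BirchSwinnertonDyer.Rank2Observatory.Δ_ne_zero_of_not_dvd V hΔ) hT hT2

/-- **(Tor) for `E₀′`: `#E₀′(ℚ)[2] = 2`** — `E₀′(ℚ)[2] = {O, (0,0)}` (`x² − 8` has no root mod `5`).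
Shu–Zhai's (Tor) for `E′ = y² = x³ − 4Ax` reads `−A ∉ ℚ²`.
[cite: ShuZhai2021, §1 condition (Tor) (arXiv:2102.11808 p. 3)] [cite: SilvermanAEC2009, Prop. VII.3.1(b)] -/
theorem natCard_twoTorsion_curve256c1' :
    Nat.card {P : (⟨0, 0, 0, -8, 0⟩ : WeierstrassCurve ℚ).toAffine.Point // (2 : ℕ) • P = 0} = 2 := by
  rw [← curve256c1'Int_map]
  haveI : Fact (Nat.Prime 5) := ⟨by norm_num⟩
  set V : WeierstrassCurve ℤ := ⟨0, 0, 0, -8, 0⟩ with hV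
  have hT : (0 : ℤ) ^ 2 + V.a₁ * 0 * 0 + V.a₃ * 0 = 0 ^ 3 + V.a₂ * 0 ^ 2 + V.a₄ * 0 + V.a₆ := by
    simp [hV]
  have hT2 : 2 * (0 : ℤ) + V.a₁ * 0 + V.a₃ = 0 := by simp [hV]
  have hΔ : ¬ ((5 : ℕ) : ℤ) ∣ V.Δ := by
    simp only [hV, WeierstrassCurve.Δ, WeierstrassCurve.b₂, WeierstrassCurve.b₄,
      WeierstrassCurve.b₆, WeierstrassCurve.b₈]
    norm_num
  have hB : BirchSwinnertonDyer.Rank2Observatory.twoTorsionOnlyB V 5 0 0 = true := by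
    rw [hV]; decide +kernel
  have h := BirchSwinnertonDyer.Rank2Observatory.twoTorsion_eq_zero_or_eq V hT hT2 5 hΔ
    (by norm_num) hB
  haveI := BirchSwinnertonDyer.Rank2Observatory.isElliptic_rat V
    (BirchSwinnertonDyer.Rank2Observatory.Δ_ne_zero_of_not_dvd V hΔ)
  refine natCard_twoTorsion_eq_two_of_subset (Affine.Point.some_ne_zero _) ?_ h
  exact BirchSwinnertonDyer.Rank2Observatory.two_nsmul_some_eq_zero V
    (BirchSwinnertonDyer.Rank2Observatory.Δ_ne_zero_of_not_dvd V hΔ) hT hT2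

/-! ## §3 The conductor: `N(E₀) ∣ 256 = 2⁸` (kernel; Cremona: `N = 256` exactly, not needed) -/

/-- **`N(E₀) ∣ 2⁸` — IN THE KERNEL**: `Δ_min = −2⁹`, so `2` is the only bad prime, and `f₂ ≤ 8`
universally (tree `conductorNorm_dvd_of_localBounds`, Brumer–Kramer / Lockhart–Rosen–Silverman bound
at `2`). [cite: Silverman1994, IV.11.1] [cite: Cremona1997, Table 1 (256c1)] -/
theorem conductorNorm_curve256c1_dvd : curve256c1.conductorNorm ℤ ∣ 256 :=
  conductorNorm_dvd_of_localBounds 0 0 0 2 0 curve256c1 rfl [(2, 9)]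
    (by intro t ht; simp only [List.mem_cons, List.not_mem_nil, or_false] at ht; rcases ht with rfl; norm_num)
    (by decide +kernel) (by norm_num) (by decide +kernel)

/-- `N(E₀) ≠ 0` (instance used by the parametrisation datum at level `N`). [folklore] -/
instance neZero_conductorNorm_curve256c1 : NeZero (curve256c1.conductorNorm ℤ) :=
  ⟨(curve256c1.conductorNorm_pos_holds).ne'⟩

/-- `N(E₀)` and `2N(E₀)` are powers of `2`: `N ∣ 2⁸`, `2N ∣ 2⁹`. [folklore] -/
theorem two_mul_conductorNorm_curve256c1_dvd : 2 * curve256c1.conductorNorm ℤ ∣ 2 ^ 9 :=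
  (mul_dvd_mul_left 2 conductorNorm_curve256c1_dvd).trans (by norm_num)

/-! ## §4 `K = ℚ(√−p)`, `p ≡ 7 (mod 8)`: `d_K = −p ≡ 1 (mod 8)`, so `2` splits — the Heegner
hypothesis of Thm 1.2 and hypothesis (ii) of Thm 1.4 at `K` -/

/-- **Every prime of `2ᵃ` splits in `F = ℚ(√−p)` for `p ≡ 7 (mod 8)`**: `d_F = −p ≡ 1 (mod 8)`
(decomposition law at `2`, tree `satisfiesHeegnerHypothesis_iff_kronecker`; `d_F = −p` by p3's
`discr_eq_neg_of_sq_eq_neg_prime`). [cite: Marcus1977, Ch. 3 Thm. 25] -/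
theorem satisfiesHeegnerHypothesis_two_pow_of_mod_eight {F : Type} [Field F] [NumberField F]
    (h2 : Module.finrank ℚ F = 2) {p : ℕ} (hp : p.Prime) (h8 : p % 8 = 7)
    {x : F} (hx : x ^ 2 = ((-(p : ℤ) : ℤ) : F)) (a : ℕ) :
    SatisfiesHeegnerHypothesis (2 ^ a) F := by
  have hD := discr_eq_neg_of_sq_eq_neg_prime h2 hp (by omega) hx
  rw [satisfiesHeegnerHypothesis_iff_kronecker _ F h2, hD]
  intro q hq hqN
  obtain rfl := (Nat.prime_dvd_prime_iff_eq hq Nat.prime_two).mp (hq.dvd_of_dvd_pow hqN)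
  exact ⟨fun _ => by omega, fun h2' => absurd rfl h2'⟩

/-- **The Heegner hypothesis of Thm 1.2 for `(256c1, ℚ(√−p))`, `p ≡ 7 (mod 8)`: every prime of `N`
splits in `ℚ(√−p)`** (`N ∣ 2⁸`; Shu–Zhai: "p satisfies the Heegner hypothesis for (E, K) if every prime
ℓ dividing N splits in K"). [cite: ShuZhai2021, Thm. 1.2 hypothesis (arXiv:2102.11808 p. 3)] -/
theorem allPrimesSplitInSqrt_conductorNorm_curve256c1 {p : ℕ} (hp : p.Prime) (h8 : p % 8 = 7) :
    AllPrimesSplitInSqrt (curve256c1.conductorNorm ℤ) (-(p : ℤ)) := by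
  refine Or.inr fun F _ _ h2 ⟨x, hx⟩ => ?_
  exact (satisfiesHeegnerHypothesis_two_pow_of_mod_eight h2 hp h8 hx 8).of_dvd
    (conductorNorm_curve256c1_dvd.trans (by norm_num))

/-- **Hypothesis (ii) of Thm 1.4 at `K`: every prime of `2N` splits in `ℚ(√−p)`**, `p ≡ 7 (mod 8)`
(`2N ∣ 2⁹`); Thm 4.10's extra condition "`p ≡ −1 (mod 8)`" is then automatic.
[cite: ShuZhai2021, Thm. 1.4 (ii) and Thm. 4.10] -/
theorem allPrimesSplitInSqrt_two_mul_conductorNorm_curve256c1 {p : ℕ} (hp : p.Prime) (h8 : p % 8 = 7) :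
    AllPrimesSplitInSqrt (2 * curve256c1.conductorNorm ℤ) (-(p : ℤ)) := by
  refine Or.inr fun F _ _ h2 ⟨x, hx⟩ => ?_
  exact (satisfiesHeegnerHypothesis_two_pow_of_mod_eight h2 hp h8 hx 9).of_dvd
    two_mul_conductorNorm_curve256c1_dvd

/-! ## §5 The setting of Shu–Zhai Thm 1.2 at `E₀ = 256c1` -/

/-- **The setting of Thm 1.2 for `E₀ = 256c1`, `K = ℚ(√−p)` (`p ≡ 7 (mod 8)` prime), `Q` admissible.**
Discharged in the kernel: the degree-`2` isogeny `E₀ → E₀′`, (Tor) for `E₀` and `E₀′`, `p > 3`,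
`p ≡ 3 (mod 4)`, the Heegner hypothesis for `N`. Kept as printed (display hypotheses on the optimal
parametrisation `X₀(256) → E₀`, lit g3 DOSSIER §16.1 rows S1/S3 — Cremona 1992 Table 1 (256C1 is the
optimal curve of its class) and Table 4 (`L(E₀,1)/Ω = 1/2`, so `f([0]) = (0,0) ∉ 2E₀(ℚ)`), to be typed as
the table fact `ShuZhai2021.base256c1_optimal_cuspZero` by the cell's literature seat): `IsOptimalDatum`,
`f([0]) ∉ 2E₀(ℚ)`; and the admissibility of the primes of `Q` (§6: every prime `q ≡ 5 (mod 8)`).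
[cite: ShuZhai2021, Thm. 1.2 (arXiv:2102.11808 p. 3)] [cite: Cremona1997, Table 1 (256c1) and Table 4 (256C)] -/
theorem thm12Setting_curve256c1 (Dt : ModularParametrizationData curve256c1 (curve256c1.conductorNorm ℤ))
    (hopt : IsOptimalDatum curve256c1 Dt) (hcusp : CuspZeroNotInTwice curve256c1 Dt)
    {p : ℕ} (hp : p.Prime) (h8 : p % 8 = 7) {Q : Finset ℕ}
    (hQ : ∀ q ∈ Q, IsAdmissible curve256c1 (⟨0, 0, 0, -8, 0⟩ : WeierstrassCurve ℚ) q ∧ q ≠ p) :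
    Thm12Setting curve256c1 Dt (⟨0, 0, 0, -8, 0⟩ : WeierstrassCurve ℚ) p Q :=
  ⟨exists_isogeny_curve256c1_degree_two, hopt, hcusp, natCard_twoTorsion_curve256c1,
    natCard_twoTorsion_curve256c1', hp, by omega, by omega,
    allPrimesSplitInSqrt_conductorNorm_curve256c1 hp h8, hQ⟩

/-! ## §6 The Manin constant of `256c1` is odd — BY NAME (Agashe–Ribet–Stein 2006 Thm 2.6 = Cremona) -/

/-- **Hypothesis (i) of Thm 1.4 ("the Manin constant of `E` is odd") for `256c1`, BY NAME**: for any
parametrisation datum `Dt` of `E₀` at level `N = N(E₀)` with the lattice equality (`E₀` optimal),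
`|c| = 1` by Agashe–Ribet–Stein 2006 Thm 2.6 / Cremona (`c_E = 1` for optimal curves of conductor
`≤ 130000`; tree fact `AgasheRibetStein2006.cremona_abs_maninConstant_eq_one_of_level_le`), since
`N(E₀) ∣ 256`; hence `2 ∤ c`. [cite: AgasheRibetStein2006, Thm. 2.6 (p. 619)] -/
theorem not_two_dvd_c_of_isOptimalDatum_curve256c1
    (hARS : AgasheRibetStein2006.cremona_abs_maninConstant_eq_one_of_level_le)
    (Dt : ModularParametrizationData curve256c1 (curve256c1.conductorNorm ℤ))
    (hopt : IsOptimalDatum curve256c1 Dt) : ¬ (2 : ℤ) ∣ Dt.c := by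
  have hN : curve256c1.conductorNorm ℤ ≤ 130000 :=
    (Nat.le_of_dvd (by norm_num) conductorNorm_curve256c1_dvd).trans (by norm_num)
  have h1 : |Dt.c| = 1 := hARS curve256c1 Dt hopt hN
  intro h2
  have h3 : (2 : ℤ) ∣ 1 := h1 ▸ (dvd_abs _ _).mpr h2
  omega

/-! ## §7 The twists: `E₀^{(D)} = (y² = x³ + 2D²x)`; the members `W_{p,M} = E₀^{(−pM)}` of the leaf -/

/-- **`E₀^{(D)} : y² = x³ + 2D²x` on the nose** (tree `quadraticTwist`: `b₂ = 0`, `b₄ = 4`, `b₆ = 0`).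
In particular `E₀^{(−pM)} = W_{p,M} : y² = x³ + 2p²M²x`. [cite: SilvermanAEC2009, X.5 Prop. 5.4 (ii)] -/
theorem quadraticTwist_curve256c1 (D : ℚ) :
    curve256c1.quadraticTwist D = (⟨0, 0, 0, 2 * D ^ 2, 0⟩ : WeierstrassCurve ℚ) := by
  ext <;> simp [WeierstrassCurve.quadraticTwist, curve256c1, WeierstrassCurve.b₂,
    WeierstrassCurve.b₄, WeierstrassCurve.b₆]
  ring

/-- **Every model of a twist of `256c1` has CM with `2` RAMIFIED in the CM field** (`j = 1728`): the
Shu–Zhai family at `256c1` lies in the ramified type of the leaf — crux 20362, child 20509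
(`RamifiedOffTYZOfFacts`), conjunct (2) "`y² = x³ + Ax`, `A, −A ∉ ℤ²`" of the atlas iff
`CornerFTwo.wAllCornerFTwoRamified_iff_models_of_transport` (`A = 2D²`).
[cite: SilvermanAEC2009, X.5 Prop. 5.4 (ii)] [cite: SilvermanATAEC1994, App. A §3] -/
theorem hasCM_and_cmRamified_two_of_smul_twist_curve256c1 {D : ℚ} (hD : D ≠ 0)
    {W : WeierstrassCurve ℚ} [W.IsElliptic] {C : VariableChange ℚ}
    (hC : C • curve256c1.quadraticTwist D = W) : W.HasCM ∧ CMRamified W 2 := by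
  rw [quadraticTwist_curve256c1] at hC
  exact CornerFTwo.hasCM_and_cmRamified_two_of_smul_quartic (mul_ne_zero two_ne_zero (pow_ne_zero 2 hD)) hC

/-- **The leaf predicate on the family**: a globally minimal model `W` of a twist of `256c1` with
`ord_{s=1} L(W,s) = 1` satisfies `CornerF W 2` (CM ∧ analytic rank one), i.e. is a MEMBER of the class
leaf — so a BSD₂ theorem on it is PARTITION currency for rung W-ALL/12.K12-2 (slice RAM).
[cite: SilvermanATAEC1994, App. A §3] -/
theorem cornerF_two_of_smul_twist_curve256c1 {D : ℚ} (hD : D ≠ 0)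
    {W : WeierstrassCurve ℚ} [W.IsElliptic] [W.IsGloballyMinimal] {C : VariableChange ℚ}
    (hC : C • curve256c1.quadraticTwist D = W) (hr : W.analyticRank = 1) : CornerF W 2 :=
  CornerFTwo.cornerF_two_iff.mpr ⟨(hasCM_and_cmRamified_two_of_smul_twist_curve256c1 hD hC).1, hr⟩

end Summit.BirchSwinnertonDyer.Rank1Residual.P2

end
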